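import Summits.CriticalPhenomena.CardyFormulaZ2.Theorems.CardyComplexConeParafermionToSLESixFamiliesReduction
import Literature.Probability.Percolation.BondInterfaceFaceDomain
import Literature.Probability.RandomPlanarGeometry.ChordalUniformizerKernelGiven
import HarnessLib

/-!
# `PercKSBoxData` from the face-domain kernel inputs and Kemppainen–Smirnov box tightness

Route `CardyComplexCone` (sub-problem `CriticalPhenomena/CardyFormulaZ2`), crux
`Summit.CriticalPhenomena.CardyFormulaZ2.Theses.CardyComplexCone.ParafermionToSLESixFamilies`
(item stmt-CriticalPhenomena-11389), line `caratheodory-net-slit-uniformity`, stub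
`stub_percKSBoxData : PercKSBoxData` (Kemppainen–Smirnov lattice data for the bond interfaces of
a discretisation family, `…Reduction.lean`). The stub is NOT proved here; this file is its
DECOMPOSITION into the two inputs that the tree does not have, with the canonical choice of the
approximating domains made once and for all:

* the approximating Dobrushin domains ARE the oriented polygonal face domains
  `orientedFaceDomain hΛ (hadm k)` of the data (`Literature/Probability/Percolation/BondInterfaceFaceDomain.lean`:
  the bond interface of every configuration runs in their closure from `pt 0` to `pt 1`; the
  kernel inputs (B), (K2) and the convergence of the marked points `a_k → a`, `b_k → b` are
  PROVED there);
* `PercFaceKernel` — the two remaining inputs of Pommerenke's kernel theorem for these domains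
  along positive admissible meshes `δ_k → 0`: (K1) every compact of `D` lies in the face domains
  for large `k`, and (ULC) their complements are uniformly locally connected (pure plane geometry
  of the lattice approximation of a Jordan domain; CDHKS 2014 §2–3 "`φ^δ → φ`"; absent from the
  tree, cf. the module docstring of `DiscreteFaceBoundary.lean`, "Not here (next files)");
* `PercFaceBoxTight` — Kemppainen–Smirnov box tightness of the interfaces read through ANY
  chordal uniformizing maps `φ_k` of the oriented face domains whose boundary extensions
  converge to that of the given `φ` ((U1), (U2)): KS Prop. 3.2 / Thms. 3.9–3.10 for the family
  `(φ_k, Law γ_{δ_k})` from Condition G2 (RSW), for the NON-SIMPLE medial exploration polyline of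
  `ℤ²` (it touches itself at doubly visited medial vertices, so the simple-curve event form
  `regularCurves` of the tree and the named fact
  `Literature.Probability.RandomPlanarGeometry.exists_regularity_of_conditionG2` do not apply
  verbatim; KS §4.1.2 work on the modified medial lattice for this reason).

`percKSBoxData_of_face : PercFaceKernel → PercFaceBoxTight → PercKSBoxData` is PROVED: the
uniformizing maps `φ_k → φ` for the GIVEN `φ` come from the kernel theorem in the form
`MarkedDomain.exists_uniformizers_of_kernel_of_isChordalUniformizing`
(`ChordalUniformizerKernelGiven.lean`) fed with (B), (K1), (K2), (ULC), `a_k → a`, `b_k → b`.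
-/

noncomputable section

open scoped Topology NNReal ENNReal
open Filter Set MeasureTheory Metric
open UpperHalfPlane (upperHalfPlaneSet)
open Literature.Probability Literature.Probability.LatticeModels Literature.Probability.Percolation
open Literature.Probability.RandomPlanarGeometry
open scoped Literature.Probability.RandomPlanarGeometry.PathBorel

namespace Summit.CriticalPhenomena.CardyFormulaZ2.Cruxes.ParafermionToSLESixFamilies.CaratheodoryNetSlitUniformity

/-- **(K1) + (ULC) for the oriented face domains of a discretisation family.** For every
Dobrushin domain `(D; a, b)`, discretisation family `Λ` and positive admissible meshes
`δ_k → 0`: (K1) every compact subset of `D` lies in the face domain of `Λ δ_k` for all large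
`k`; (ULC) for every `η > 0` some `ε > 0` such that, for all large `k`, two boundary points of
the face domain of `Λ δ_k` at distance `< ε` lie in a continuum of its complement inside the
`η`-disc about the first — the hypotheses `hK1`, `hlc` of
`MarkedDomain.exists_uniformizers_of_kernel(_of_isChordalUniformizing)` (Pommerenke 1992,
Cor. 2.4) for these polygonal approximations (CDHKS 2014, §3: "`φ^δ → φ` uniformly on compact
subsets", and up to the boundary). The research-free but unformalised geometric input of
`PercKSBoxData`. -/
def PercFaceKernel : Prop :=
  ∀ (D : DobrushinDomain) (Λ : ℝ → DiscreteDobrushin) (hΛ : ZdDiscretisationFamily D Λ)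
    (δs : ℕ → ℝ), (∀ k, 0 < δs k) → Tendsto δs atTop (𝓝 0) →
    ∀ hadm : ∀ k, (Λ (δs k)).IsZdAdmissible,
    (∀ K : Set ℂ, IsCompact K → K ⊆ D.carrier →
      ∀ᶠ k in atTop, K ⊆ (orientedFaceDomain hΛ (hadm k)).carrier) ∧
    (∀ η : ℝ, 0 < η → ∃ ε > 0, ∀ᶠ k in atTop,
      ∀ a ∈ frontier (orientedFaceDomain hΛ (hadm k)).carrier,
      ∀ b ∈ frontier (orientedFaceDomain hΛ (hadm k)).carrier, dist a b < ε →
        ∃ σ ⊆ (orientedFaceDomain hΛ (hadm k)).carrierᶜ, IsCompact σ ∧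
          IsPreconnected σ ∧ a ∈ σ ∧ b ∈ σ ∧ σ ⊆ closedBall a η)

/-- **Kemppainen–Smirnov box tightness of the bond interfaces in the oriented face domains.**
For every Dobrushin domain `(D; a, b)`, discretisation family `Λ`, chordal uniformizing map `φ`
of `D`, positive admissible meshes `δ_k → 0`, and every system of chordal uniformizing maps
`φ_k` of the oriented face domains `(D_k; a_k, b_k)` of the data whose boundary extensions
converge to that of `φ` ((U1) on the compacts of the closed half-plane, (U2) at infinity): for
every `ε > 0` ONE box of Loewner pairs (moduli `δγ, δW > 0`, transience profile `T`) such that,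
at every scale, with `Pc`-probability `≥ 1 - ε` the interface `Literature.Probability.Percolation.bondInterfaceIn D (Λ δ_k)` is
`⟦Φ_k ∘ γ̂⟧` for a pair `(γ̂, W)` in the box — KS Prop. 3.2 with Thms. 3.9–3.10 (from
Condition G2, i.e. RSW on `ℤ²`) for the raw, non-simple medial exploration polyline (describable
through `φ_k` as a non-self-traversing Loewner curve); the box clause of `PercKSBoxData` with the
domains fixed. The research-level input of `PercKSBoxData`. -/
def PercFaceBoxTight : Prop :=
  ∀ (D : DobrushinDomain) (Λ : ℝ → DiscreteDobrushin) (hΛ : ZdDiscretisationFamily D Λ)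
    (φ : ConformalEquiv upperHalfPlaneSet D.carrier), D.IsChordalUniformizing φ →
    ∀ (δs : ℕ → ℝ), (∀ k, 0 < δs k) → Tendsto δs atTop (𝓝 0) →
    ∀ (hadm : ∀ k, (Λ (δs k)).IsZdAdmissible)
      (φs : ∀ k, ConformalEquiv upperHalfPlaneSet (orientedFaceDomain hΛ (hadm k)).carrier),
      (∀ k, (orientedFaceDomain hΛ (hadm k)).IsChordalUniformizing (φs k)) →
      (∀ R : ℝ, TendstoUniformlyOn (fun k ↦ (φs k).boundaryExtension) φ.boundaryExtension
        atTop ({z : ℂ | 0 ≤ z.im} ∩ closedBall 0 R)) →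
      (∀ ε : ℝ, 0 < ε → ∃ r : ℝ, ∀ᶠ k in atTop, ∀ z : ℂ, z ∈ {z : ℂ | 0 ≤ z.im} → r ≤ ‖z‖ →
        dist ((φs k).boundaryExtension z) ((orientedFaceDomain hΛ (hadm k)).pt 1) ≤ ε) →
      ∀ ε : ℝ≥0∞, 0 < ε → ∃ (δγ δW : ℕ → ℝ) (T : ℕ → ℝ≥0), (∀ j, 0 < δγ j) ∧
        (∀ j, 0 < δW j) ∧
        ∀ k, Pc ((Literature.Probability.Percolation.bondInterfaceIn D (Λ (δs k))) ⁻¹'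
          ((fun p ↦ compactifiedClass (φs k).boundaryExtension
              ((orientedFaceDomain hΛ (hadm k)).pt 1) p.1) ''
            {p : C(ℝ≥0, ℂ) × C(ℝ≥0, ℝ) | p ∈ generatedPairs ∧
              p.1 ∈ Process.modulusSet ({0} : Set ℂ) δγ ∧
              p.2 ∈ Process.modulusSet ({0} : Set ℝ) δW ∧
              ∀ (j : ℕ) (t : ℝ≥0), T j ≤ t → (j : ℝ) ≤ ‖p.1 t‖})ᶜ) ≤ ε

/-- **`PercKSBoxData` from the face-domain kernel inputs and box tightness** (glue of the
decomposition). Take `D_k :=` the oriented face domain of `Λ δ_k`; its inputs (B), (K2)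
(`exists_forall_orientedFaceDomain_subset_ball`, `not_ball_subset_orientedFaceDomain`) and
`a_k → a`, `b_k → b` (`tendsto_pt_orientedFaceDomain`) are proved, (K1), (ULC) are
`PercFaceKernel`; the kernel theorem for the GIVEN `φ`
(`MarkedDomain.exists_uniformizers_of_kernel_of_isChordalUniformizing`) yields chordal maps
`φ_k` with (U1), (U2); `PercFaceBoxTight` is the box clause. -/
theorem percKSBoxData_of_face : PercFaceKernel → PercFaceBoxTight → PercKSBoxData := by
  intro h1 h2 D Λ hΛ φ hφ δs hpos hlim hadm
  set Ds : ℕ → DobrushinDomain := fun k ↦ orientedFaceDomain hΛ (hadm k) with hDs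
  obtain ⟨hK1, hlc⟩ := h1 D Λ hΛ δs hpos hlim hadm
  obtain ⟨R, hR, hB⟩ := exists_forall_orientedFaceDomain_subset_ball hΛ
  have hB' : ∃ R > 0, ∀ᶠ k in atTop, (Ds k).carrier ⊆ ball 0 R :=
    ⟨R, hR, Eventually.of_forall fun k ↦ hB (hadm k)⟩
  have hK2 : ∀ w ∉ D.carrier, ∀ r : ℝ, 0 < r → ∀ᶠ k in atTop, ¬ ball w r ⊆ (Ds k).carrier :=
    fun w hw r hr ↦ Eventually.of_forall fun k ↦ not_ball_subset_orientedFaceDomain hΛ (hadm k) hw hr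
  obtain ⟨ha, hb⟩ := tendsto_pt_orientedFaceDomain hΛ hpos hlim hadm
  obtain ⟨φs, hφs, -, hU1, hU2⟩ :=
    MarkedDomain.exists_uniformizers_of_kernel_of_isChordalUniformizing (Ds := Ds) hB' hK1 hK2 hlc
      ha hb φ hφ
  exact ⟨Ds, φs, hφs, hU1, hU2, hb, h2 D Λ hΛ φ hφ δs hpos hlim hadm φs hφs hU1 hU2⟩

end Summit.CriticalPhenomena.CardyFormulaZ2.Cruxes.ParafermionToSLESixFamilies.CaratheodoryNetSlitUniformity

end
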